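import Mathlib
import HarnessLib
import Summits.NavierStokesRegularity.NavierStokesRegularity.Theorems.PoloidalWindowDoorLrcModEntireTwistingTHFlatRidgeQuarticForm

/-!
# Item `LrcModEntire` (stmt-NavierStokesRegularity-20428) — THE FLAT SUB-CELL: at a CROSSING (two independent hot secant directions) the whole FOURTH derivative vanishes

ns-k2-port-2 g7, helper of item 20428 (LEAD lineage ns-poloidal-K2-p3; `--supports stmt-NavierStokesRegularity-20428 --as helper`).  Memo `Cruxes/LrcModEntire/T2B-g15.md` §17a
(«the ridge law first: … a crossing of two branches has order ≥ 8»), pointwise and branch-free: if hot points of the flat cell accumulate at `y ∈ P₀` along TWO linearly independent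
horizontal unit directions `T, T'` (two hot sequences with different limit secants), then each is in the kernel of `D⁴θ(y)` (`secantKernel_of_tendsto`, the sequence form of
`…FlatRidgeSecantPin.exists_secantKernel_of_flatHotPoint`), the kernel is linear in that slot, so EVERY horizontal vector is in the kernel; by the Schwarz symmetries every
component with a horizontal inner slot vanishes, and the purely vertical block is slaved to the horizontal one (`…FlatRidgeQuarticNormalForm`: `D⁴[c,d,e₂,e₂] = −μ₀D⁴[c,d,ν,ν]`).
Hence **`D⁴θ(y) = 0` entirely**: at a crossing `θ − N` vanishes to order five (so, `u ≥ 0`, its transversal quartic coefficient `q` is zero in every direction).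

* `secantKernel_of_tendsto` — sequence form of the secant kernel;
* `horizKernel_of_two` — two independent horizontal kernel directions ⇒ every horizontal vector is a kernel direction;
* ★ `fourthDeriv_eq_zero_of_twoSecantKernels` — `D²(x ↦ D²θ(x)[a][b])(y) = 0` for all `a b`.

WHAT THIS IS NOT: not a claim about Navier–Stokes regularity and not a proof of `stub_T2bFlat`; a pointwise structure statement for the OPEN flat sub-cell (bears_on LADDER-NS N0,
item 20428 / crux 19708; OPEN).
-/

set_option linter.style.longLine false
set_option linter.dupNamespace false

namespace Summit.NavierStokesRegularity.NavierStokesRegularity.Theorems.PoloidalWindowDoorLrcModEntireTwistingTHFlatRidgeCrossing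

open Set Function Filter Topology Metric
open scoped RealInnerProductSpace InnerProductSpace ContDiff
open Literature.Analysis Literature.Analysis.FluidPDE Literature.Analysis.UnboundedOperators
open Summit.NavierStokesRegularity.NavierStokesRegularity.Theorems
open Summit.NavierStokesRegularity.NavierStokesRegularity.Theorems.LocalSineTubeDoorProfileAlignedWindowRigidityAncient
open Summit.NavierStokesRegularity.NavierStokesRegularity.Theorems.PoloidalWindowDoorLrcModEntireRidgeWiring
open Summit.NavierStokesRegularity.NavierStokesRegularity.Theorems.PoloidalWindowDoorLrcModEntireTwistingTHFlatRidgeThirdJet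
open Summit.NavierStokesRegularity.NavierStokesRegularity.Theorems.PoloidalWindowDoorLrcModEntireTwistingTHFlatRidgeSecantPin
open Summit.NavierStokesRegularity.NavierStokesRegularity.Theorems.PoloidalWindowDoorLrcModEntireTwistingTHFlatRidgeQuarticNormalForm
open Summit.NavierStokesRegularity.NavierStokesRegularity.Theorems.PoloidalWindowDoorLrcModEntireTwistingTHFlatRidgeQuarticForm

/-! ### Class-free: two independent horizontal kernel directions give the whole horizontal plane -/

/-- If two horizontal vectors `T, T'` with `T₀T'₁ − T₁T'₀ ≠ 0` are in the kernel of a linear map `Φ` on `ℝ³`, so is every horizontal vector. [folklore] -/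
theorem horizKernel_of_two {F : Type*} [NormedAddCommGroup F] [NormedSpace ℝ F] (Φ : EuclideanSpace ℝ (Fin 3) →L[ℝ] F)
    {T T' : EuclideanSpace ℝ (Fin 3)} (hT2 : T 2 = 0) (hT'2 : T' 2 = 0) (hdet : T 0 * T' 1 - T 1 * T' 0 ≠ 0)
    (hT : Φ T = 0) (hT' : Φ T' = 0) {h : EuclideanSpace ℝ (Fin 3)} (hh : h 2 = 0) : Φ h = 0 := by
  set δ : ℝ := T 0 * T' 1 - T 1 * T' 0 with hδ
  set α : ℝ := (h 0 * T' 1 - h 1 * T' 0) / δ with hα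
  set β : ℝ := (h 1 * T 0 - h 0 * T 1) / δ with hβ
  have hdec : h = α • T + β • T' := by
    ext i
    fin_cases i
    · show h 0 = (α • T + β • T') 0
      simp only [PiLp.add_apply, PiLp.smul_apply, smul_eq_mul, hα, hβ]
      field_simp
      ring
    · show h 1 = (α • T + β • T') 1
      simp only [PiLp.add_apply, PiLp.smul_apply, smul_eq_mul, hα, hβ]
      field_simp
      ring
    · show h 2 = (α • T + β • T') 2
      simp [hh, hT2, hT'2]
  rw [hdec, map_add, map_smul, map_smul, hT, hT', smul_zero, smul_zero, add_zero]

variable {C : ℝ} {v : ℝ → EuclideanSpace ℝ (Fin 3) → EuclideanSpace ℝ (Fin 3)}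

/-- **Sequence form of the secant kernel:** hot points `z n` of `P₀` with `z n → y` and secants `‖z n − y‖⁻¹(z n − y)` converging to `T` along a subsequence `φ` (`T` is a unit vector when `z n ≠ y` eventually; the conclusion is linear in `T`, so no such hypothesis is needed):
then `D²(x ↦ D²θ(x)[a][b])(y)[T][w] = 0` for all `a b w` (flat law at every hot point of `P₀`). -/
theorem secantKernel_of_tendsto (hdec : HasTypeITimeDecay C v) (hcont : ContinuousOn (uncurry v) (Iio (0 : ℝ) ×ˢ univ))
    (hmild : ∀ s t : ℝ, s < t → t < 0 → ∀ x, v t x = heatExtension (v s) (t - s) x - oseenDuhamel 1 s v v t x)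
    (hdiv : ∀ t < 0, VectorCalculus.IsDivFree (v t))
    (hTH : ∀ t < 0, ∀ x x' : EuclideanSpace ℝ (Fin 3), x 2 = x' 2 → ∀ b c : Fin 3, b ≠ 2 → c ≠ 2 →
      fderiv ℝ (v t) x (EuclideanSpace.single 2 1) b * fderiv ℝ (v t) x' (EuclideanSpace.single c 1) 2 =
        fderiv ℝ (v t) x' (EuclideanSpace.single 2 1) c * fderiv ℝ (v t) x (EuclideanSpace.single b 1) 2)
    (hne : v (-1) 0 2 ≠ 0) (hhot : ∀ t < 0, ∀ x, Real.sqrt (-t) * |v t x 2| ≤ |v (-1) 0 2|)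
    (hproper : ∀ y ∈ {y : EuclideanSpace ℝ (Fin 3) | y 2 = 0 ∧ v (-1) y 2 = v (-1) 0 2}, ∀ r : ℝ, 0 < r →
      ∃ y' : EuclideanSpace ℝ (Fin 3), y' 2 = 0 ∧ dist y' y < r ∧ v (-1) y' 2 ≠ v (-1) 0 2)
    {σ : ℝ} (hσN : σ * v (-1) 0 2 = |v (-1) 0 2|)
    (hflatAll : ∀ y : EuclideanSpace ℝ (Fin 3), y 2 = 0 → v (-1) y 2 = v (-1) 0 2 →
      fderiv ℝ (fderiv ℝ (fun x => σ * v (-1) x 2)) y (EuclideanSpace.single 0 1) (EuclideanSpace.single 0 1) +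
        fderiv ℝ (fderiv ℝ (fun x => σ * v (-1) x 2)) y (EuclideanSpace.single 1 1) (EuclideanSpace.single 1 1) = 0)
    {y : EuclideanSpace ℝ (Fin 3)} (hy0 : y 2 = 0) (hy : v (-1) y 2 = v (-1) 0 2)
    {z : ℕ → EuclideanSpace ℝ (Fin 3)} (hz2 : ∀ n, z n 2 = 0) (hzv : ∀ n, v (-1) (z n) 2 = v (-1) 0 2)
    (hzt : Tendsto z atTop (𝓝 y)) {φ : ℕ → ℕ} (hφ : StrictMono φ) {T : EuclideanSpace ℝ (Fin 3)}
    (hTlim : Tendsto (fun n => ‖z (φ n) - y‖⁻¹ • (z (φ n) - y)) atTop (𝓝 T)) (a b w : EuclideanSpace ℝ (Fin 3)) :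
    fderiv ℝ (fderiv ℝ (fun x => fderiv ℝ (fderiv ℝ (fun x' => (v (-1) x' 2 : ℝ))) x a b)) y T w = 0 := by
  set θ : EuclideanSpace ℝ (Fin 3) → ℝ := fun x => v (-1) x 2 with hθdef
  have hθ : ContDiff ℝ 4 θ := contDiff_two_component hdec hcont hmild
  set H : EuclideanSpace ℝ (Fin 3) → ℝ := fun x => fderiv ℝ (fderiv ℝ θ) x a b with hHdef
  have hH : ContDiff ℝ 2 H := contDiff_hessianEntry hθ a b
  have hGzero : ∀ y' : EuclideanSpace ℝ (Fin 3), y' 2 = 0 → v (-1) y' 2 = v (-1) 0 2 → fderiv ℝ H y' = 0 := by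
    intro y' hy'0 hy'
    have h3 := thirdDeriv_two_eq_zero_of_flatHotPoint hdec hcont hmild hdiv hTH hne hhot hproper hσN hy'0 hy' (hflatAll y' hy'0 hy')
    ext e
    have hD2d : DifferentiableAt ℝ (fderiv ℝ (fderiv ℝ θ)) y' :=
      (((hθ.fderiv_right (m := 3) (by norm_num)).fderiv_right (m := 2) (by norm_num)).differentiable (by norm_num)) y'
    have hb : fderiv ℝ H y' e = fderiv ℝ (fderiv ℝ (fderiv ℝ θ)) y' e a b := by
      rw [hHdef, show (fun x => fderiv ℝ (fderiv ℝ θ) x a b) = fun x => (fun x' => fderiv ℝ (fderiv ℝ θ) x' a) x b from rfl,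
        fderiv_clm_apply (hD2d.clm_apply (differentiableAt_const _)) (differentiableAt_const _)]
      simp [fderiv_apply_const_apply_eq_fderiv_fderiv hD2d]
    rw [hb, hθdef, h3]
    simp
  set u : ℕ → EuclideanSpace ℝ (Fin 3) := fun n => ‖z n - y‖⁻¹ • (z n - y) with hudef
  have hD : HasFDerivAt (fderiv ℝ H) (fderiv ℝ (fderiv ℝ H) y) y :=
    (((hH.fderiv_right (m := 1) (by norm_num)).differentiable one_ne_zero) y).hasFDerivAt
  have ht := (hasFDerivAt_iff_tendsto.1 hD).comp hzt
  have heq : (fun n => ‖z n - y‖⁻¹ * ‖fderiv ℝ H (z n) - fderiv ℝ H y - fderiv ℝ (fderiv ℝ H) y (z n - y)‖) =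
      fun n => ‖fderiv ℝ (fderiv ℝ H) y (u n)‖ := by
    funext n
    rw [hGzero (z n) (hz2 n) (hzv n), hGzero y hy0 hy, sub_zero, zero_sub, norm_neg, hudef]
    simp only
    rw [map_smul, norm_smul, norm_inv, norm_norm]
  have ht' : Tendsto (fun n => ‖fderiv ℝ (fderiv ℝ H) y (u n)‖) atTop (𝓝 0) := by
    have := ht; rw [Function.comp_def] at this; simpa only [heq] using this
  have hsub : Tendsto (fun n => ‖fderiv ℝ (fderiv ℝ H) y (u (φ n))‖) atTop (𝓝 0) := ht'.comp hφ.tendsto_atTop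
  have hcontn : Continuous fun x => ‖fderiv ℝ (fderiv ℝ H) y x‖ := (fderiv ℝ (fderiv ℝ H) y).continuous.norm
  have hlim2 : Tendsto (fun n => ‖fderiv ℝ (fderiv ℝ H) y (u (φ n))‖) atTop (𝓝 ‖fderiv ℝ (fderiv ℝ H) y T‖) :=
    (hcontn.tendsto T).comp hTlim
  have h0 : ‖fderiv ℝ (fderiv ℝ H) y T‖ = 0 := tendsto_nhds_unique hlim2 hsub
  have hT0 : fderiv ℝ (fderiv ℝ H) y T = 0 := norm_eq_zero.1 h0
  rw [hT0, zero_apply]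

/-- ★ **AT A CROSSING THE WHOLE FOURTH DERIVATIVE VANISHES.**  Flat-cell binders (class, poloidality, (TH), normalisation, `hproper`, «no compact isolated hot piece», flat law at
every hot point of `P₀`), a hot point `y ∈ P₀`, and TWO horizontal unit vectors `T, T'` with `T₀T'₁ − T₁T'₀ ≠ 0` that are kernel directions of `D⁴θ(y)` (e.g. two limit secants,
`secantKernel_of_tendsto`) ⇒ `D²(x ↦ D²v₂(−1,x)[a][b])(y) = 0` for all `a b`. -/
theorem fourthDeriv_eq_zero_of_twoSecantKernels (hdec : HasTypeITimeDecay C v) (hcont : ContinuousOn (uncurry v) (Iio (0 : ℝ) ×ˢ univ))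
    (hmild : ∀ s t : ℝ, s < t → t < 0 → ∀ x, v t x = heatExtension (v s) (t - s) x - oseenDuhamel 1 s v v t x)
    (hdiv : ∀ t < 0, VectorCalculus.IsDivFree (v t))
    (hpol : ∀ s < 0, ∀ y, ⟪curl (v s) y, EuclideanSpace.single 2 1⟫_ℝ = 0)
    (hTH : ∀ t < 0, ∀ x x' : EuclideanSpace ℝ (Fin 3), x 2 = x' 2 → ∀ b c : Fin 3, b ≠ 2 → c ≠ 2 →
      fderiv ℝ (v t) x (EuclideanSpace.single 2 1) b * fderiv ℝ (v t) x' (EuclideanSpace.single c 1) 2 =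
        fderiv ℝ (v t) x' (EuclideanSpace.single 2 1) c * fderiv ℝ (v t) x (EuclideanSpace.single b 1) 2)
    (hne : v (-1) 0 2 ≠ 0) (hhot : ∀ t < 0, ∀ x, Real.sqrt (-t) * |v t x 2| ≤ |v (-1) 0 2|)
    (hproper : ∀ y ∈ {y : EuclideanSpace ℝ (Fin 3) | y 2 = 0 ∧ v (-1) y 2 = v (-1) 0 2}, ∀ r : ℝ, 0 < r →
      ∃ y' : EuclideanSpace ℝ (Fin 3), y' 2 = 0 ∧ dist y' y < r ∧ v (-1) y' 2 ≠ v (-1) 0 2)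
    (hni : ∀ K O : Set (EuclideanSpace ℝ (Fin 3)), IsCompact K → K.Nonempty → K ⊆ {y : EuclideanSpace ℝ (Fin 3) | y 2 = 0 ∧ v (-1) y 2 = v (-1) 0 2} →
      IsOpen O → K ⊆ O → O ∩ {y : EuclideanSpace ℝ (Fin 3) | y 2 = 0 ∧ v (-1) y 2 = v (-1) 0 2} ⊆ K → False)
    {σ : ℝ} (hσN : σ * v (-1) 0 2 = |v (-1) 0 2|)
    (hflatAll : ∀ y : EuclideanSpace ℝ (Fin 3), y 2 = 0 → v (-1) y 2 = v (-1) 0 2 →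
      fderiv ℝ (fderiv ℝ (fun x => σ * v (-1) x 2)) y (EuclideanSpace.single 0 1) (EuclideanSpace.single 0 1) +
        fderiv ℝ (fderiv ℝ (fun x => σ * v (-1) x 2)) y (EuclideanSpace.single 1 1) (EuclideanSpace.single 1 1) = 0)
    {y : EuclideanSpace ℝ (Fin 3)} (hy0 : y 2 = 0) (hy : v (-1) y 2 = v (-1) 0 2)
    {T T' : EuclideanSpace ℝ (Fin 3)} (hT2 : T 2 = 0) (hT'2 : T' 2 = 0) (hdet : T 0 * T' 1 - T 1 * T' 0 ≠ 0)
    (hT : ∀ a b w : EuclideanSpace ℝ (Fin 3), fderiv ℝ (fderiv ℝ (fun x => fderiv ℝ (fderiv ℝ (fun x' => (v (-1) x' 2 : ℝ))) x a b)) y T w = 0)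
    (hT' : ∀ a b w : EuclideanSpace ℝ (Fin 3), fderiv ℝ (fderiv ℝ (fun x => fderiv ℝ (fderiv ℝ (fun x' => (v (-1) x' 2 : ℝ))) x a b)) y T' w = 0)
    (a b : EuclideanSpace ℝ (Fin 3)) :
    fderiv ℝ (fderiv ℝ (fun x => fderiv ℝ (fderiv ℝ (fun x' => (v (-1) x' 2 : ℝ))) x a b)) y = 0 := by
  set θ : EuclideanSpace ℝ (Fin 3) → ℝ := fun x' => v (-1) x' 2 with hθdef
  have hθ : ContDiff ℝ 4 θ := contDiff_two_component hdec hcont hmild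
  -- every horizontal vector is a kernel direction (first outer slot)
  have hker : ∀ h : EuclideanSpace ℝ (Fin 3), h 2 = 0 → ∀ a b w : EuclideanSpace ℝ (Fin 3),
      fderiv ℝ (fderiv ℝ (fun x => fderiv ℝ (fderiv ℝ θ) x a b)) y h w = 0 := by
    intro h hh a b w
    have hk := horizKernel_of_two (fderiv ℝ (fderiv ℝ (fun x => fderiv ℝ (fderiv ℝ θ) x a b)) y) hT2 hT'2 hdet
      (by ext w'; simpa using hT a b w') (by ext w'; simpa using hT' a b w') hh
    rw [hk, zero_apply]
  -- a horizontal vector in ANY slot kills the component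
  have hslot2 : ∀ h : EuclideanSpace ℝ (Fin 3), h 2 = 0 → ∀ a b c : EuclideanSpace ℝ (Fin 3),
      fderiv ℝ (fderiv ℝ (fun x => fderiv ℝ (fderiv ℝ θ) x a b)) y c h = 0 := fun h hh a b c => by
    rw [fourthDeriv_symm_outer hθ a b c h]; exact hker h hh a b c
  have hslot3 : ∀ h : EuclideanSpace ℝ (Fin 3), h 2 = 0 → ∀ b c d : EuclideanSpace ℝ (Fin 3),
      fderiv ℝ (fderiv ℝ (fun x => fderiv ℝ (fderiv ℝ θ) x h b)) y c d = 0 := fun h hh b c d => by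
    rw [fourthDeriv_symm_middle hθ h b c d]; exact hslot2 h hh d b c
  have hslot4 : ∀ h : EuclideanSpace ℝ (Fin 3), h 2 = 0 → ∀ a c d : EuclideanSpace ℝ (Fin 3),
      fderiv ℝ (fderiv ℝ (fun x => fderiv ℝ (fderiv ℝ θ) x a h)) y c d = 0 := fun h hh a c d => by
    rw [fourthDeriv_symm_inner hθ a h]; exact hslot3 h hh a c d
  -- the purely vertical inner block is slaved to a horizontal one
  obtain ⟨μ₀, -, T₀, hT₀2, -, -, hii, -⟩ :=
    quarticNormalForm_of_flatHotPoint hdec hcont hmild hdiv hpol hTH hne hhot hproper hni hσN hflatAll hy0 hy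
  set ν₀ : EuclideanSpace ℝ (Fin 3) := (-T₀ 1) • EuclideanSpace.single 0 (1 : ℝ) + T₀ 0 • EuclideanSpace.single 1 (1 : ℝ) with hν₀
  have hν₀2 : ν₀ 2 = 0 := by simp [hν₀]
  have hvert : ∀ c d : EuclideanSpace ℝ (Fin 3),
      fderiv ℝ (fderiv ℝ (fun x => fderiv ℝ (fderiv ℝ θ) x (EuclideanSpace.single 2 1) (EuclideanSpace.single 2 1))) y c d = 0 := by
    intro c d
    rw [hθdef, hii c d]
    change (-μ₀) * fderiv ℝ (fderiv ℝ (fun x => fderiv ℝ (fderiv ℝ θ) x ν₀ ν₀)) y c d = 0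
    rw [hslot3 ν₀ hν₀2 ν₀ c d, mul_zero]
  -- decompose the inner slots into horizontal + vertical parts
  set e₂ : EuclideanSpace ℝ (Fin 3) := EuclideanSpace.single 2 1 with he₂
  have hsplit : ∀ a : EuclideanSpace ℝ (Fin 3), a = (a - a 2 • e₂) + a 2 • e₂ := fun a => by rw [sub_add_cancel]
  have hhor : ∀ a : EuclideanSpace ℝ (Fin 3), (a - a 2 • e₂) 2 = 0 := fun a => by simp [he₂]
  ext c d
  rw [zero_apply, zero_apply]
  have e1 : fderiv ℝ (fderiv ℝ (fun x => fderiv ℝ (fderiv ℝ θ) x a b)) y =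
      fderiv ℝ (fderiv ℝ (fun x => fderiv ℝ (fderiv ℝ θ) x (a - a 2 • e₂) b)) y +
        a 2 • fderiv ℝ (fderiv ℝ (fun x => fderiv ℝ (fderiv ℝ θ) x e₂ b)) y := by
    conv_lhs => rw [hsplit a]
    rw [fourthDeriv_inner_add hθ, fourthDeriv_inner_smul hθ]
  have e2 : fderiv ℝ (fderiv ℝ (fun x => fderiv ℝ (fderiv ℝ θ) x e₂ b)) y =
      fderiv ℝ (fderiv ℝ (fun x => fderiv ℝ (fderiv ℝ θ) x e₂ (b - b 2 • e₂))) y +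
        b 2 • fderiv ℝ (fderiv ℝ (fun x => fderiv ℝ (fderiv ℝ θ) x e₂ e₂)) y := by
    conv_lhs => rw [hsplit b]
    rw [fourthDeriv_symm_inner hθ e₂ ((b - b 2 • e₂) + b 2 • e₂), fourthDeriv_inner_add hθ, fourthDeriv_inner_smul hθ,
      fourthDeriv_symm_inner hθ (b - b 2 • e₂) e₂, fourthDeriv_symm_inner hθ e₂ e₂]
  change fderiv ℝ (fderiv ℝ (fun x => fderiv ℝ (fderiv ℝ θ) x a b)) y c d = 0
  rw [e1]
  simp only [add_apply, smul_apply, smul_eq_mul]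
  rw [hslot3 _ (hhor a) b c d, e2]
  simp only [add_apply, smul_apply, smul_eq_mul]
  rw [hslot4 _ (hhor b) e₂ c d, he₂, hvert c d]
  ring

end Summit.NavierStokesRegularity.NavierStokesRegularity.Theorems.PoloidalWindowDoorLrcModEntireTwistingTHFlatRidgeCrossing
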